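import Mathlib
import HarnessLib
import HarnessLib.Audit
import Summits.NavierStokesRegularity.Statement
import Literature.Analysis.FluidPDE.ClassicalSolution
import Literature.Analysis.FluidPDE.LerayHopf
import Literature.Analysis.FluidPDE.VectorCalculus
import Literature.Analysis.FluidPDE.NSWave0
import HarnessLib.Audit.Status.Attr

/-!
Route: ContinuousAlignment

DORMANT since 2026-08-25T15:18:57Z (reconciler: no traction for 7.8 d (last activity item-evidence-added at 2026-08-17T19:18:14Z); parked, not closed — `ledger route dormant route-NavierStokesRegularity-ContinuousAlignment --off` to rea) — unstaffed, not closed; items shared with open routes are served there. `ledger route dormant <id> --off` reactivates.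

# Route ContinuousAlignment — rate-free Constantin–Fefferman criterion at Hölder exponent 0⁺
(attacked) + a-priori continuous alignment of the vorticity direction (residual)

It suffices to show X = W2 ∧ W1 (typed from the markdown sketch
`vorticity-direction-apriori-alignment`, reader verdict PASS).
Setting: ν > 0, T > 0, (u,p) a classical Navier–Stokes solution on ℝ³×[0,T) (f = 0) that is
Leray–Hopf from its rapidly decaying datum u(0);
ω = curl u, ξ = ω/|ω| written inline as ‖ω x‖⁻¹ • ω x (definitionally the in-tree
`vorticityDirection`, `rfl`; kept inline so the
route does not import `Literature.Analysis.FluidPDE.Vorticity` — cone repair 2026-08-17), alignment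
measured by the sine |sin∠(ξ(t,x),ξ(t,y))| = √(1 − ⟪ξx,ξy⟫²) (sign-insensitive:
anti-parallel counts as aligned). ALIGNED(d) := ∀ε>0 ∃δ>0 ∀t<T ∀x,y: |ω(t,x)|,|ω(t,y)| > d ∧ |x−y| <
δ ⇒ sine ≤ ε (a uniform-in-time modulus of
continuity of ξ on the high set). W2 (ContinuousAlignmentCriterion, ATTACKED conjunct, rank 2):
ALIGNED(d) for some d > 0 ⇒ the solution
extends smoothly past T — the Constantin–Fefferman criterion with the rate removed from the modulus
(Lipschitz: CF93; σ^½: BdVB02; any modulus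
only under Type I: GigaMiura2011). W1 (AprioriContinuousAlignment, RESIDUAL conjunct, rank 3): every
such solution is ALIGNED(d) for every d > 0.
S ⟺ W1 ∧ W2 (conjunct split, declared: attacked W2, residual W1); neither alone gives S.
Lean: `(∀ (ν T : ℝ), 0 < ν → 0 < T → ∀ (u : ℝ → EuclideanSpace ℝ (Fin 3) → EuclideanSpace ℝ (Fin 3))
(p : ℝ → EuclideanSpace ℝ (Fin 3) → ℝ), Literature.Analysis.FluidPDE.IsClassicalNSSolutionOn
(Set.Ico 0 T) ν 0 u p → Literature.Analysis.FluidPDE.IsLerayHopfOn T ν 0 (u 0) u →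
Literature.Analysis.FluidPDE.HasRapidSpatialDecay (u 0) → ∀ d : ℝ, 0 < d → ∀ ε : ℝ, 0 < ε → ∃ δ : ℝ,
0 < δ ∧ ∀ t ∈ Set.Ico 0 T, ∀ x y : EuclideanSpace ℝ (Fin 3), d < ‖Literature.Analysis.FluidPDE.curl
(u t) x‖ → d < ‖Literature.Analysis.FluidPDE.curl (u t) y‖ → ‖x - y‖ < δ → Real.sqrt (1 - (inner ℝ
(‖Literature.Analysis.FluidPDE.curl (u t) x‖⁻¹ • Literature.Analysis.FluidPDE.curl (u t) x)
(‖Literature.Analysis.FluidPDE.curl (u t) y‖⁻¹ • Literature.Analysis.FluidPDE.curl (u t) y)) ^ 2) ≤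
ε) ∧ (∀ (ν T : ℝ), 0 < ν → 0 < T → ∀ (u : ℝ → EuclideanSpace ℝ (Fin 3) → EuclideanSpace ℝ (Fin 3))
(p : ℝ → EuclideanSpace ℝ (Fin 3) → ℝ), Literature.Analysis.FluidPDE.IsClassicalNSSolutionOn
(Set.Ico 0 T) ν 0 u p → Literature.Analysis.FluidPDE.IsLerayHopfOn T ν 0 (u 0) u →
Literature.Analysis.FluidPDE.HasRapidSpatialDecay (u 0) → ∀ d : ℝ, 0 < d → (∀ ε : ℝ, 0 < ε → ∃ δ :
ℝ, 0 < δ ∧ ∀ t ∈ Set.Ico 0 T, ∀ x y : EuclideanSpace ℝ (Fin 3), d <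
‖Literature.Analysis.FluidPDE.curl (u t) x‖ → d < ‖Literature.Analysis.FluidPDE.curl (u t) y‖ → ‖x -
y‖ < δ → Real.sqrt (1 - (inner ℝ (‖Literature.Analysis.FluidPDE.curl (u t) x‖⁻¹ •
Literature.Analysis.FluidPDE.curl (u t) x) (‖Literature.Analysis.FluidPDE.curl (u t) y‖⁻¹ •
Literature.Analysis.FluidPDE.curl (u t) y)) ^ 2) ≤ ε) →
Literature.Analysis.FluidPDE.HasSmoothExtensionPast ν 0 u T)`

## Assembly
Pure logic (sorry-free in Sketch.lean, theorem assembly_proof, 2 lines): fix ν, T, u, p in the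
NoBlowup premises; W1 with d := 1 gives the alignment
clause; W2 with d := 1 gives HasSmoothExtensionPast ν 0 u T; NoBlowupToClay gives Clay (A). The
deciding theorem `closes` (glue.lean) consumes the
Assembly item together with both cruxes and the support item (`closes hA h₁ h₂ h₃ := hA h₁ h₂ h₃`),
so every declared item is a load-bearing binder (BC6).

Rationale: WHY THIS LINE. Vortex stretching is depleted where vorticity directions are locally parallel
(Constantin's singular-integral identity Â(x,η,x) = 0,
ConstantinFefferman1993; textbook form LemarieRieusset2016 Thm 11.7), and the only printed
regularity criteria on ξ carry a RATE (Lipschitz,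
½-Hölder) or a blow-up-rate hypothesis (Type I, GigaMiura2011 via the KNSS2009 zoom and the planar
Liouville theorem, GigaHsuMaekawa2014
arXiv:1310.6471 p.16). W2 isolates the rate-free endpoint that Beirão da Veiga prints as open
(arXiv:1604.08083 §6, p.9) and attacks it
by a REGIME dichotomy instead of a rate: in the vorticity-dominated regime ‖u‖²∞ ≲ ‖ω‖∞ a zoom at
vorticity records keeps the velocity
bounded, the fixed-scale modulus becomes constancy of direction in the KNSS limit, and the
unidirectional Liouville lemma of route
DirectionDissipationQuantum (item stmt-1923, resting on the PROVED in-tree KNSS planar Liouville)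
kills it — no rate needed; the
velocity-dominated regime (Burgers-vortex-like strained 2D profiles, MajdaBertozzi2002 eq. (2.72))
is named as the open half. W1 is the
a-priori half, declared residual (its only inputs are the max-point alignment inequality and
Constantin1990's energy-class budget
∫∫|ω||∇ξ|² ≤ ½ν⁻²‖u₀‖²). Imported areas: parabolic blow-up/compactness + Liouville rigidity
(KNSS2009), geometric depletion
(ConstantinFefferman1993), differential geometry of the direction field. Versus the superseded route
VorticityGeometry (X = a-priori
LIPSCHITZ coherence with ∃-threshold, grounder: X ⟺ NoBlowup): the modulus is arbitrary, the
threshold universal, and the criterion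
half is a separate rate-free crux with its own rung and skeleton.

RANKED CRUXES. #2 ContinuousAlignmentCriterion (crux) — W2, the RATE-FREE CONTINUOUS-ALIGNMENT
CRITERION (attacked conjunct): for ν>0, T>0 and a classical NS solution on ℝ³×[0,T), Leray–Hopf from
a rapidly decaying datum, and a threshold d>0: if the vorticity direction is uniformly continuous on
{|ω|>d} uniformly in t<T (∀ε ∃δ ∀t<T ∀x,y: |ω(t,x)|,|ω(t,y)|>d, |x−y|<δ ⇒ √(1−⟪ξx,ξy⟫²) ≤ ε), then
the solution extends smoothly past T (HasSmoothExtensionPast). Printed rungs: Lipschitz modulus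
(CF93 = in-tree fact constantin_fefferman; BC5 rung proved from it), σ^½ (BdVB02,
LemarieRieusset2016 Thm 11.7), any modulus under Type I (GigaMiura2011; GHM14 Thm 1.2). Skeleton:
aligned zoom in the vorticity-dominated regime + UnidirectionalAncientLiouville (shared with DDQ
stmt-1923) + the velocity-dominated regime. [difficulty: open-problem] (why it might fail: BdV16
p.3: beating β=½ 'could be as hard as extending LPS beyond λ>1'; a velocity-dominated aligned
Type-II blow-up zooms to a Burgers-type strained 2D vortex (exact steady NS, bounded unidirectional
ω), which no Liouville theorem excludes.) [ConstantinFefferman1993, arXiv:1604.08083,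
doi:10.57262/die/1356060864, GigaMiura2011, GigaHsuMaekawa2014, arXiv:2607.08866, KNSS2009,
MajdaBertozzi2002]
#3 AprioriContinuousAlignment (crux) — W1, A-PRIORI CONTINUOUS ALIGNMENT (residual conjunct,
declared `residual`): for ν>0, T>0 and every classical NS solution on ℝ³×[0,T), Leray–Hopf from a
rapidly decaying datum, and EVERY threshold d>0, the vorticity direction is uniformly continuous
(sine of the angle, sign-insensitive) on {|ω|>d}, uniformly in t<T (∀ε ∃δ …). Trivial for solutions
extending past T (δ = εd/(2 sup|∇ω|)); the content is 'a blow-up cannot be scale-invariant in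
direction at a fixed vorticity level'. Only a-priori inputs in hand: the max-point alignment
inequality D⁺‖ω‖∞ ≤ (α − ν|∇ξ|²)‖ω‖∞ and Constantin1990's budget ∫∫|ω||∇ξ|² ≤ ½ν⁻²‖u₀‖² (energy
class). [difficulty: open-problem] (why it might fail: Energy-supercritical: a discretely
self-similar or Type-II collapse with direction pattern ξ ≈ Ξ((x−x*)/ℓ(t)), ℓ→0, has no t-uniform
modulus; skewed (non-antiparallel) tube collisions shrink the alignment scale before reconnecting
(MoffattKimura2019, Hou2022).) [Constantin1990, ConstantinFefferman1993, MoffattKimura2019,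
Hou2022PotentiallySingularNS, arXiv:2511.00725,
Literature.Barriers.NavierStokesRegularity.EnergySupercriticality]
#9 NoBlowupToClay (support) — given no blow-up (every finite-energy classical solution from a
rapidly decaying datum extends past every T), build the Clay (A) solution — item
stmt-NavierStokesRegularity-0055, PROVED (typeICertificateLadder_noBlowupToClay_proof); shared.
[difficulty: provable-now] [Leray1934, Fefferman2000]

TWO-LAYER PLAN. W2 ⇐ AlignedZoomVD → UnidirectionalAncientLiouville (= DDQ stmt-1923, shared) →
VelocityDominatedAligned → W2 (the registered birth skeleton,
by cases on the vorticity-dominated regime VD: ∃C ∀t<T ∀x ∃y ‖u(t,x)‖² ≤ C(1+‖ω(t,y)‖)); W1 ⇐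
RegularAligned → SingularAligned → W1 (by cases on
HasSmoothExtensionPast). Filed as glued splits only after the tribunal; k ≤ 3 each, depth 1.

KILL CRITERIA. A continuously aligned blow-up (even in a faithful NS setting with a direction field:
axisymmetric-with-swirl or Hou-type data whose ξ stays
uniformly continuous on {|ω|>d} while |ω|→∞) refutes W2: close
`refuted:ContinuousAlignmentCriterion`. A finite-energy Schwartz-datum solution whose
direction modulus on some {|ω|>d} degenerates before T refutes W1 (= exhibits blow-up:
¬Clay(A)-level event). VelocityDominatedAligned refuted with
the VD half standing ⇒ pivot (tenure): re-target W2 to the vorticity-dominated criterion (GM without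
rate) as a FRONTIER theorem. NoBlowup proved
elsewhere moots the route; Type-I exclusion proved elsewhere does NOT (W2's open half is Type II).

NOT DECOMPOSED YET. The zoom/compactness lemma at vorticity records (C¹_loc convergence of rescaled
vorticity, passage of the fixed-scale modulus to constancy of
direction, mildness of the limit — KNSS2009 §6 tools, in-tree KNSS2009_blowup_generates_ancient
gives existence only); the planar descent inside
UnidirectionalAncientLiouville (DDQ's item); the regular-case lemma of W1 (closed-slab Sobolev
bounds, PROVED in tree, + |sin∠| ≤ |ξx−ξy| ≤ 2|ωx−ωy|/d);
any engine for SingularAligned (none claimed: residual); Dini vs non-Dini moduli (Grujić 2026 works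
below Dini under a critical profile) — layer 2.

CHEAPEST FALSIFIER. Literature/posing check the tribunal can run this week: is 'continuous alignment
without Type I ⇒ regularity' already claimed or refuted in print
(GigaMiura2011 §1 remarks; Grujić arXiv:2607.08866 §1; Barker–Prange arXiv:1906.08225)? — my reads:
GHM14 p.3 says Type I is used exactly to stop the
limit being constant; none claims the rate-free case. Model check: in the Burgers vortex
(MajdaBertozzi2002 (2.72)) and in Hou's axisymmetric
scenario (arXiv:2107.06509) compute the alignment modulus on {|ω|>d} against peak vorticity — a
uniformly continuous ξ with unbounded |ω| in a
genuine NS computation kills W2 in practice.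

NUMBERS. Known moduli: η(σ)=Aσ (CF93), Aσ^½ (BdVB02; LemarieRieusset2016 Thm 11.7), any η under sup
(T−t)^½‖u‖∞ < ∞ (GigaMiura2011 = GHM14 Thm 1.2),
bmo_{1/|log r|} under |ω| ≲ |x|⁻² (Grujić 2026). A-priori: ∫₀ᵀ∫|ω||∇ξ|² ≤ ½ν⁻²‖u₀‖²₂
(Constantin1990; Cannone LNM1871 p.47). Items at open: 4 (2 cruxes, 1 support, assembly);
load-bearing open binders of `closes`: 2.

DEFINITION REQUESTS. None: curl, vorticityDirection, IsClassicalNSSolutionOn, IsLerayHopfOn,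
HasRapidSpatialDecay, HasSmoothExtensionPast, IsKNSSBlowupLimit,
IsBoundedAncientMildSolution all exist in Literature.Analysis.FluidPDE. (A named notion
`IsContinuouslyAlignedOn u T d` for the ε–δ clause would
shorten the items; not requested — inlined as in VorticityGeometry/DirectionDissipationQuantum.)

Novelty: Searches (2026-08-17): `lit search --hybrid "vorticity direction Hölder continuity regularity
criterion Navier-Stokes Beirão da Veiga Berselli"` (12 held
books: LemarieRieusset2016 pp.368-370 READ = Thm 11.7; Cannone2006 p.47 READ; MajdaBertozzi2002);
`lit read arXiv:1604.08083 --grep` (p.3 caveat, p.9 open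
problem READ); `lit read arXiv:1310.6471 --grep alignment` (GHM14 Thm 1.2 + p.3/p.16 READ: Type I
used only to stop the limit being constant); `lit read
arXiv:2607.08866` (Grujić 2026 §1–2 READ: bmo_log under critical profile; cites GM as the
uniform-continuity threshold UNDER TYPE I); `lit galaxy search
--star all "direction of vorticity|…"` (36 rows, noise) and `--star pdf "Constantin and Fefferman"`
(5: galaxy:pdf:796229340 Dascaliuc–Grujić
arXiv:1107.0058, galaxy:pdf:1422089413116032900 Grujić arXiv:1111.0217 — conditional criteria); `lit
frontier NavierStokesRegularity --since 2023` (25 rows,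
none on direction criteria); `ledger negatives` (4, none related); 79 NS Theses grepped by the
reader (no W1/W2 item).
Nearest prior art found: GigaMiura2011 / GigaHsuMaekawa2014 Thm 1.2 (any modulus, TYPE I),
doi:10.57262/die/1356060864 (BdVB02, σ^½), ConstantinFefferman1993
(Lipschitz; in-tree fact), arXiv:1604.08083 (BdV16: β<½ printed open), arXiv:2607.08866 (Grujić
2026: bmo_log under a critical L^{3/2,∞} profile);
in-tree: closed route VorticityGeometry (a-priori Lipschitz, ∃-threshold ⟺ NoBlowup) and open
DirectionDissipationQuantum (integral pivot G, Type-I crux B).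
Delta  [refs: 10.57262/die/1356060864, 1604.08083, 1310.6471, 2607.08866, 1107.0058, 1111.0217, doi:10.57262/die/1356060864, LemarieRieusset2016, MajdaBertozzi2002, GigaMiura2011, GigaHsuMaekawa2014, ConstantinFefferman1993]

Barriers (technique_class: geometric-depletion blowup-liouville direction-modulus): - technique_class: geometric-depletion blowup-liouville direction-modulus
- Literature.Barriers.NavierStokesRegularity.EnergySupercriticality: W2 sits OUTSIDE the class (a
conditional criterion whose hypothesis is dimensionless and becomes scale-invariant — constancy of
direction — in any zoom; closed by compactness + Liouville rigidity, no coercive energy-class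
quantity claimed); W1 sits INSIDE it and does not evade it: the only a-priori direction control
(Constantin1990) has energy scaling — declared residual, the bet being the max-point alignment
inequality plus reconnection dynamics.
- Literature.Barriers.NavierStokesRegularity.TaoAveragedBlowup: evaded in form for both — depletion
and the 2D reduction use ω = curl u, div ω = 0, the exact Biot–Savart antisymmetry Â(x,η,x)=0 and
vorticity transport, none of which an averaged bilinear operator keeps (Tao 2016 Thm 1.5 class).
- Literature.Barriers.NavierStokesRegularity.NavierStokesInequalitySingularSolution: not in the
CKN/NSI iteration class — W2's skeleton uses the vorticity EQUATION (zoom of classical solutions,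
mild limits), which Scheffer-type NSI solutions do not satisfy.
- Literature.Barriers.NavierStokesRegularity.AxisymmetricTypeIExclusion: consistent — the
Type-I/axisymmetric regime where S is known is strictly inside W2's vorticity-dominated half; the
BC5 rung (CF93 Lipschitz, all large data) lies outside every regime where S is known.
- Literature.Barriers.NavierStokesRegularity.InstantaneousTypeIBlowup: does no

History (route lifecycle, newest last):
- 2026-08-17T16:43:58Z · rev 1: restated ContinuousAlignmentCriterion (stmt-NavierStokesRegularity-18334), AprioriContinuousAlignment (stmt-NavierStokesRegularity-18335) — route-repair (cone, rrepair 2026-08-17): drop `import Literature.Analysis.FluidPDE.Vorticity` — its deprecated REFUTED named fact `IsVorticitySolutionOn.exists_ (planner-rrepair-NavierStokesRegularity-Continu-24fa2151-0)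
- 2026-08-25T15:18:57Z · DORMANT — reconciler: no traction for 7.8 d (last activity item-evidence-added at 2026-08-17T19:18:14Z); parked, not closed — `ledger route dormant route-NavierStokesRegu (operator:999:4145598)

sub-problem: NavierStokesRegularity · status: dormant · opened planner-type-edfc07f9e0-0 2026-08-17T14:57:44Z · rev 1 · ledger route-NavierStokesRegularity-ContinuousAlignment
GENERATED by the gate from the ledger (D-0016/17). Provers cite these decls: `theorem foo : Summit.NavierStokesRegularity.NavierStokesRegularity.Theses.ContinuousAlignment.<Decl> := …` in Summits/NavierStokesRegularity/NavierStokesRegularity/Theorems/<Name>.lean.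
-/

namespace Summit.NavierStokesRegularity.NavierStokesRegularity.Theses.ContinuousAlignment

open scoped BigOperators Topology Manifold Classical MeasureTheory ProbabilityTheory Matrix InnerProductSpace ComplexConjugate ContinuousMap
open Filter Set Function TopologicalSpace MeasureTheory

attribute [summit_statement] _root_.NavierStokesRegularity

open Literature.NS

-- earlier ContinuousAlignmentCriterion (stmt-NavierStokesRegularity-18334, replaced 2026-08-17T16:43:58Z -> stmt-NavierStokesRegularity-18584): retired by None — ∀ (ν T : ℝ), 0 < ν → 0 < T → ∀ (u : ℝ → EuclideanSpace ℝ (Fin 3) → EuclideanSpace ℝ (Fin 3)) (p : ℝ → EuclideanSpace ℝ (Fin 3) → ℝ), Literature.Analysis.FluidPDE.IsClassicalNSSolutionOn (Set.Ico 0 T) ν 0 u p → Literature.Analysis.FluidPDE.I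
/-- item stmt-NavierStokesRegularity-18584 · crux · rank 2 · open · by planner
why it might fail: BdV16 p.3: beating β=½ 'could be as hard as extending LPS beyond λ>1'; a velocity-dominated aligned Type-II blow-up zooms to a Burgers-type strained 2D vortex (exact steady NS, bounded unidirectional ω), which no Liouville theorem excludes.
sources: ConstantinFefferman1993, arXiv:1604.08083, doi:10.57262/die/1356060864, GigaMiura2011, GigaHsuMaekawa2014, arXiv:2607.08866
[crux] W2, the RATE-FREE CONTINUOUS-ALIGNMENT CRITERION (attacked conjunct): for ν>0, T>0 and a
classical NS solution on ℝ³×[0,T), Leray–Hopf from a rapidly decaying datum, and a threshold d>0: if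
the vorticity direction is uniformly continuous on {|ω|>d} uniformly in t<T (∀ε ∃δ ∀t<T ∀x,y:
|ω(t,x)|,|ω(t,y)|>d, |x−y|<δ ⇒ √(1−⟪ξx,ξy⟫²) ≤ ε), then the solution extends smoothly past T
(HasSmoothExtensionPast). Printed rungs: Lipschitz modulus (CF93 = in-tree fact
constantin_fefferman; BC5 rung proved from it), σ^½ (BdVB02, LemarieRieusset2016 Thm 11.7), any
modulus under Type I (GigaMiura2011; GHM14 Thm 1.2). Skeleton: aligned zoom in the
vorticity-dominated regime + UnidirectionalAncientLiouville (shared with DDQ stmt-1923) + the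
velocity-dominated regime. [difficulty: open-problem] -/
@[route_item "route-NavierStokesRegularity-ContinuousAlignment", crux]
def ContinuousAlignmentCriterion : Prop :=
  ∀ (ν T : ℝ), 0 < ν → 0 < T → ∀ (u : ℝ → EuclideanSpace ℝ (Fin 3) → EuclideanSpace ℝ (Fin 3)) (p : ℝ → EuclideanSpace ℝ (Fin 3) → ℝ), Literature.Analysis.FluidPDE.IsClassicalNSSolutionOn (Set.Ico 0 T) ν 0 u p → Literature.Analysis.FluidPDE.IsLerayHopfOn T ν 0 (u 0) u → Literature.Analysis.FluidPDE.HasRapidSpatialDecay (u 0) → ∀ d : ℝ, 0 < d → (∀ ε : ℝ, 0 < ε → ∃ δ : ℝ, 0 < δ ∧ ∀ t ∈ Set.Ico 0 T, ∀ x y : EuclideanSpace ℝ (Fin 3), d < ‖Literature.Analysis.FluidPDE.curl (u t) x‖ → d < ‖Literature.Analysis.FluidPDE.curl (u t) y‖ → ‖x - y‖ < δ → Real.sqrt (1 - (inner ℝ (‖Literature.Analysis.FluidPDE.curl (u t) x‖⁻¹ • Literature.Analysis.FluidPDE.curl (u t) x) (‖Literature.Analysis.FluidPDE.curl (u t) y‖⁻¹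 • Literature.Analysis.FluidPDE.curl (u t) y)) ^ 2) ≤ ε) → Literature.Analysis.FluidPDE.HasSmoothExtensionPast ν 0 u T

-- earlier AprioriContinuousAlignment (stmt-NavierStokesRegularity-18335, replaced 2026-08-17T16:43:58Z -> stmt-NavierStokesRegularity-18585): retired by None — ∀ (ν T : ℝ), 0 < ν → 0 < T → ∀ (u : ℝ → EuclideanSpace ℝ (Fin 3) → EuclideanSpace ℝ (Fin 3)) (p : ℝ → EuclideanSpace ℝ (Fin 3) → ℝ), Literature.Analysis.FluidPDE.IsClassicalNSSolutionOn (Set.Ico 0 T) ν 0 u p → Literature.Analysis.FluidPDE.IsL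
/-- item stmt-NavierStokesRegularity-18585 · crux · rank 3 · open · by planner
why it might fail: Energy-supercritical: a discretely self-similar or Type-II collapse with direction pattern ξ ≈ Ξ((x−x*)/ℓ(t)), ℓ→0, has no t-uniform modulus; skewed (non-antiparallel) tube collisions shrink the alignment scale before reconnecting (MoffattKimura2019, Hou2022).
sources: Constantin1990, ConstantinFefferman1993, MoffattKimura2019, Hou2022PotentiallySingularNS, arXiv:2511.00725, Literature.Barriers.NavierStokesRegularity.EnergySupercriticality
[crux] W1, A-PRIORI CONTINUOUS ALIGNMENT (residual conjunct, declared `residual`): for ν>0, T>0 and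
every classical NS solution on ℝ³×[0,T), Leray–Hopf from a rapidly decaying datum, and EVERY
threshold d>0, the vorticity direction is uniformly continuous (sine of the angle, sign-insensitive)
on {|ω|>d}, uniformly in t<T (∀ε ∃δ …). Trivial for solutions extending past T (δ = εd/(2 sup|∇ω|));
the content is 'a blow-up cannot be scale-invariant in direction at a fixed vorticity level'. Only
a-priori inputs in hand: the max-point alignment inequality D⁺‖ω‖∞ ≤ (α − ν|∇ξ|²)‖ω‖∞ and
Constantin1990's budget ∫∫|ω||∇ξ|² ≤ ½ν⁻²‖u₀‖² (energy class). [difficulty: open-problem] -/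
@[route_item "route-NavierStokesRegularity-ContinuousAlignment", crux]
def AprioriContinuousAlignment : Prop :=
  ∀ (ν T : ℝ), 0 < ν → 0 < T → ∀ (u : ℝ → EuclideanSpace ℝ (Fin 3) → EuclideanSpace ℝ (Fin 3)) (p : ℝ → EuclideanSpace ℝ (Fin 3) → ℝ), Literature.Analysis.FluidPDE.IsClassicalNSSolutionOn (Set.Ico 0 T) ν 0 u p → Literature.Analysis.FluidPDE.IsLerayHopfOn T ν 0 (u 0) u → Literature.Analysis.FluidPDE.HasRapidSpatialDecay (u 0) → ∀ d : ℝ, 0 < d → ∀ ε : ℝ, 0 < ε → ∃ δ : ℝ, 0 < δ ∧ ∀ t ∈ Set.Ico 0 T, ∀ x y : EuclideanSpace ℝ (Fin 3), d < ‖Literature.Analysis.FluidPDE.curl (u t) x‖ → d < ‖Literature.Analysis.FluidPDE.curl (u t) y‖ → ‖x - y‖ < δ → Real.sqrt (1 - (inner ℝ (‖Literature.Analysis.FluidPDE.curl (u t) x‖⁻¹ • Literature.Analysis.FluidPDE.curl (u t) x) (‖Literature.Analysis.FluidPDE.curl (u t) y‖⁻¹ • Literature.Analysis.FluidPDE.curl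 (u t) y)) ^ 2) ≤ ε

/-- item stmt-NavierStokesRegularity-15607 · support · rank 9 · closed · proved by Summit.NavierStokesRegularity.NavierStokesRegularity.Theorems.continuousAlignment_noBlowupToClay_proof @ 6b20035d4dc4 (prover) · by planner
sources: Leray1934, Fefferman2000
[support] shared local-theory assembly (verbatim stmt-NavierStokesRegularity-0055, PROVED in tree by
Theorems.typeICertificateLadder_noBlowupToClay_proof): NoBlowup → Clay (A). [difficulty:
provable-now] -/
@[route_item "route-NavierStokesRegularity-ContinuousAlignment", crux]
def NoBlowupToClay : Prop :=
  (∀ (ν T : ℝ), 0 < ν → 0 < T → ∀ (u : ℝ → EuclideanSpace ℝ (Fin 3) → EuclideanSpace ℝ (Fin 3)) (p : ℝ → EuclideanSpace ℝ (Fin 3) → ℝ), Literature.Analysis.FluidPDE.IsClassicalNSSolutionOn (Set.Ico 0 T) ν 0 u p → Literature.Analysis.FluidPDE.IsLerayHopfOn T ν 0 (u 0) u → Literature.Analysis.FluidPDE.HasRapidSpatialDecay (u 0) → Literature.Analysis.FluidPDE.HasSmoothExtensionPast ν 0 u T) → NavierStokesRegularity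

/-- item stmt-NavierStokesRegularity-18336 · assembly · rank 1 · closed · proved by Summit.NavierStokesRegularity.NavierStokesRegularity.Theorems.continuousAlignment_assembly_proof @ 90a46e8d0acf (prover) · by planner
sources: Fefferman2000, ConstantinFefferman1993
[assembly] AprioriContinuousAlignment → ContinuousAlignmentCriterion → NoBlowupToClay →
NavierStokesRegularity. -/
@[route_item "route-NavierStokesRegularity-ContinuousAlignment", crux]
def Assembly : Prop :=
  AprioriContinuousAlignment → ContinuousAlignmentCriterion → NoBlowupToClay → NavierStokesRegularity

/-! D-0027 §2.1 — DECIDING THEOREM (planner-authored via `route open/edit --closes-file`; by planner-type-edfc07f9e0-0 2026-08-17T14:57:44Z):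
its hypotheses are this route's items and its conclusion the sub-problem Statement (glue_lint), and it elaborates with this file. -/

/-- D-0027 §2.1 deciding theorem of route ContinuousAlignment. Every declared item is a binder (BC6):
the Assembly item `AprioriContinuousAlignment → ContinuousAlignmentCriterion → NoBlowupToClay → NavierStokesRegularity`
(pure logic with threshold `d := 1`, proved sorry-free as `assembly_proof` in the planner's Sketch.lean:
`fun h₁ h₂ h₃ => h₃ fun ν T hν hT u p hcl hLH hdec => h₂ ν T hν hT u p hcl hLH hdec 1 one_pos (h₁ ν T hν hT u p hcl hLH hdec 1 one_pos)`)
is applied to W1 (`AprioriContinuousAlignment`, residual conjunct), W2 (`ContinuousAlignmentCriterion`, attacked conjunct)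
and `NoBlowupToClay` (= stmt-NavierStokesRegularity-0055, PROVED). -/
@[closes "route-NavierStokesRegularity-ContinuousAlignment"] theorem closes (hA : Assembly) (h₁ : AprioriContinuousAlignment) (h₂ : ContinuousAlignmentCriterion)
    (h₃ : NoBlowupToClay) : NavierStokesRegularity :=
  hA h₁ h₂ h₃

end Summit.NavierStokesRegularity.NavierStokesRegularity.Theses.ContinuousAlignment
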